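import Mathlib
import Summits.ResolutionOfSingularities.ResolutionOfSingularities.Theses.ShadowGame
import Summits.ResolutionOfSingularities.ResolutionOfSingularities.Theorems.ShadowGameWinR.Negative.MirrorR
import Summits.ResolutionOfSingularities.ResolutionOfSingularities.Theorems.ShadowGameWinR.Negative.Certificate
import Summits.ResolutionOfSingularities.ResolutionOfSingularities.Theorems.ShadowGameWinR.Negative.Assembly

/-!
# Refutation of `ShadowGame.ShadowGameWinR` (route ShadowGame, rev 3; stmt-ResolutionOfSingularities-18182)

`ShadowGameWinR` claims that for every prime `p` and every `n ≥ 1` the resolver A has a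
shadow-measurable winning strategy in the REPAIRED `α_p`-torsor base-blow-up game `SG^R_p(n)` (rev 3:
the terminal whistle `Terminal′` is blown modulo formal re-parametrisation and `p`-th powers).  It is
FALSE already for `n = 3`, for EVERY prime `p` (formalised for all `p`; the refutation instantiates
`p = 2`): nature B beats every strategy — shadow-measurable or not — with FIXED answers.

Witness (lead prover-line-stmt-ResolutionOfSingularities-18182-0, 2026-08-17).  Over `𝔽_p`:
* start `c₀ = x · Π₀^p`, `Π₀ = (1 − x)³ y² − W³`, `W = z − x − x z`: the surface `Π₀ = 0` has a
  CUSPIDAL EDGE along the smooth curve `{y = 0, z = x/(1−x)}`, whose Taylor coefficients are all `1`,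
  so that it is never a coordinate axis in any of B's charts — A (coordinate-stratum centres only) can
  never blow it up;
* B answers every centre `F ∋ x` in the chart `x` with translations `τ_y = 0, τ_z = 1` (it follows the
  edge), the centre `{y, z}` in the chart `z` with `τ_y = 0`, singletons trivially
  (`MirrorR.chartR / tauR`);
* every position is then `x · Π^p · E^p`, `Π = x^a z^{2e} U y² − x^b W³` with units `U, E`
  (`Assembly.runR_fst_posSt`, closed-form rules `stub_closure`, orders `stub_orders`, and the
  dictionary `stub_dictionary` identifying the game's move with honest substitution of power series);
* no position is `Terminal′` (`Certificate.not_terminalR_posSt`): a terminal position `w^A v + g^p`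
  would put `M · ŵ ∈ J(f) ⊆ (Π^p)` (`stub_structure`); shearing by `θ : z ↦ z + x/(1−x)` and taking
  weighted initial forms (`stub_initialForm`) makes the PRIME binomial `c·x^{a+2e−μ}y² − x^{b−μ}z³`
  (`stub_psiPrime`) divide the initial form of an order-one series — impossible by weights.
Geometry: `Z^p = x·Π^p` is `(Z/Π)^p = x` in disguise (resolved by normalising); B is the valuation
following the cuspidal edge of `Π`, which A's alphabet (coordinate strata in B's charts) never reaches,
and the repaired whistle (monomial × unit up to FORMAL coordinates and `p`-th powers) cannot absorb the
non-unit `p`-th power `Π^p`.  This is the route's KILL CRITERION (ii) at `n = 3`: a defect of the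
coordinate-stratum move alphabet, not a threat to local uniformization in dimension three.
Class: refuted-SUBSTANTIVE for the certificate as a game (no side condition repairs it: B's data are
generic — any surface with a non-rational-polynomial cuspidal edge works, over any perfect field).
-/

set_option linter.dupNamespace false -- mandated namespace `Summit.<S>.<S>.Theorems` of this single-conjunct summit

namespace Summit.ResolutionOfSingularities.ResolutionOfSingularities.Theorems

open Summit.ResolutionOfSingularities.ResolutionOfSingularities.Theses.ShadowGame (ShadowGameWinR)
open Summit.ResolutionOfSingularities.ResolutionOfSingularities.Theorems.ShadowGameWinR.Negative

/-- **B wins `SG^R_p(3)` for every prime `p`**: A has NO winning strategy in the repaired shadow game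
in three variables (shadow-measurable or not). [folklore] -/
theorem ShadowGameWinR_B_wins (p : ℕ) [Fact p.Prime] : ¬ AWinsR p 3 := by
  rintro ⟨strat, hne, hwin⟩
  haveI : PerfectField (ZMod p) := PerfectField.ofFinite
  obtain ⟨m, hm⟩ := hwin (ZMod p) (c0R (ZMod p) p) (iSeqR (ZMod p) p strat) (fun _ => tauR (ZMod p))
    (fun m => by rw [play_eq_runR]; exact chartR_mem (hne _ _))
  rw [play_eq_runR] at hm
  obtain ⟨a, e, b, U, E, hU, hE, hrun⟩ := runR_fst_posSt p (ZMod p) strat hne m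
  rw [hrun] at hm
  exact not_terminalR_posSt p a e b U E hU hE hm

/-- **REFUTATION of the crux `ShadowGameWinR`** (stmt-ResolutionOfSingularities-18182, route
ShadowGame rev 3): nature B wins the repaired game `SG^R_2(3)` against every strategy of the
resolver (in fact `SG^R_p(3)` for every prime `p`, `ShadowGameWinR_B_wins`).
refuted-substantive: the load-bearing claim (a coordinate-stratum strategy reaching Terminal′) fails at
`n = 3`; witness `x · ((1−x)³y² − (z−x−xz)³)^p` over `𝔽_p` with B's fixed answers; no cheap repair
(the cuspidal edge is generic and formal re-parametrisation is already allowed in the whistle).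
[folklore] -/
theorem not_ShadowGameWinR : ¬ ShadowGameWinR := fun h =>
  ShadowGameWinR_B_wins 2 (shadowGameWinR_iff.mp h 2 Nat.prime_two 3 (by norm_num))

end Summit.ResolutionOfSingularities.ResolutionOfSingularities.Theorems
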